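import Summits.NavierStokesRegularity.FluidComputer.GateBudgetCleanHorizon
import HarnessLib

/-!
# GateBudget part 119 — the clean dud horizon, hypothesis-minimal headline (§315–§316)

Cell `pub-fluidc`, blueprint seat bp1 (gen 40); namespace
`Summit.NavierStokesRegularity.FluidComputer.GateBudget`, headline member
`RotorKnob.rotorCircuit K K¹⁰ ε ρ` of the two-scale family from `delayInit` (5.6), `K ≥ 16`, UNIT
LATTICE `ε = K¹⁰ρ²` (`k = 1`); modes `0 = a` (carrier), `1 = b` (clock), `2 = c` (trigger),
`3 = d` (transfer), `4 = ã` (output). HONEST FRAMING: a low prior, high value-of-information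
experiment on Tao's machine paradigm; NOT a claim that NS blows up.

WHY. Part 118 §314 `knob_clean_horizon_two_sided` is the thread's headline, but as typed it carries
two pieces of scaffolding a reader of the paper should not have to parse: a trigger primitive `C`
with `C' = c` (which exists on EVERY trajectory — part 14 `exists_catalyst_primitive`, `C = ∫₀ᵗ c`)
and the amplitude `ε` with three side conditions (`0 < ε`, `ε² ≤ 1/(6K²⁰)`, `ε = K¹⁰ρ²`) that on
the unit lattice are ONE condition on `ρ`. This file files the same theorem with exactly the data
a statement about one ODE trajectory needs: the vector field, the initial condition, `K ≥ 16`,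
and the small parameter `ρ` with `ρ⁴ ≤ 1/(6K⁴⁰)`.

WHAT. §315 `headline_lattice_numerics`: `K ≥ 16`, `0 < ρ`, `ρ⁴ ≤ 1/(6K⁴⁰)` give `0 < K¹⁰ρ²` and
`(K¹⁰ρ²)² ≤ 1/(6K²⁰)`. §316 `knob_clean_horizon_headline` — THE CLEAN DUD HORIZON OF THE
HEADLINE MEMBER (hypothesis-minimal): if `X` solves (5.5) for `rotorCircuit K K¹⁰ (K¹⁰ρ²) ρ` with
`X(0) = delayInit`, `K ≥ 16`, `0 < ρ`, `ρ⁴ ≤ 1/(6K⁴⁰)`, then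
`0.065K⁹ ≤ cleanHorizon K (K¹⁰ρ²) ρ X (29/20)` and, for every `5/4 ≤ Θ ≤ 3/2`,
`cleanHorizon K (K¹⁰ρ²) ρ X Θ ≤ ΘK⁹/(7·1.83) + 1`. §316 `knob_clean_horizon_order` — the same
at the ladder's own clock ceiling `Θ = 29/20` with both edges as decimals:
`0.065K⁹ ≤ cleanHorizon K (K¹⁰ρ²) ρ X (29/20) ≤ 0.1132K⁹ + 1` — the clean dud horizon of the
headline member is of exact order `K⁹`, with the two constants a factor `1.74` apart.

HOW. §315 is `positivity` and `(K¹⁰ρ²)² = K²⁰ρ⁴ ≤ K²⁰/(6K⁴⁰) = 1/(6K²⁰)`; §316 is part 118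
§314 at `ε := K¹⁰ρ²` with `C` from part 14 and `hlat := rfl`; the order form is
`(29/20)/(7·1.83) = 0.11319… ≤ 0.1132`.

WHAT THIS BUYS. One citable statement whose hypotheses are only "(5.5) from (5.6), `K ≥ 16`,
`ρ⁴ ≤ 1/(6K⁴⁰)`", for the paper's §2 scorecard row; no new mathematics.
HONEST LIMITS. (i) `k = 1` only (parts 100–118 are); (ii) `ρ⁴ ≤ 1/(6K⁴⁰)` IS `ε² ≤ 1/(6K²⁰)`
on the lattice — no new regime is covered; (iii) the factor `1.74` between the edges is part
118's real slack (`U = 2` vs `≈ 1.55a²/θ` on the floor, `1.83` vs `1.90` on the ceiling), not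
rounding, and is not attacked here; (iv) nothing about Navier–Stokes: these are inequalities about
Tao's five-mode toy circuit (5.5)/(5.6).
[cite: Tao2016AveragedNS, §5.5 Theorem 5.3, (5.5), (5.6), (b-eq), (c-eq), (d-eq), (ta-eq),
(energy-con), (est)]
-/

noncomputable section

namespace Summit.NavierStokesRegularity.FluidComputer.GateBudget

open Real Set Filter Topology
open Literature.Analysis.FluidPDE.Tao2016AveragedNS

variable {K ρ : ℝ} {X : ℝ → Fin 5 → ℝ}

/-! ## §315 The unit lattice read from `ρ` -/

/-- §315 THE UNIT LATTICE READ FROM `ρ`: for `K ≥ 16`, `0 < ρ` and `ρ⁴ ≤ 1/(6K⁴⁰)`, the lattice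
amplitude `ε := K¹⁰ρ²` satisfies `0 < ε` and `ε² ≤ 1/(6K²⁰)` — the two side conditions on `ε`
carried by parts 100–118. [folklore] -/
theorem headline_lattice_numerics (hK : 16 ≤ K) (hρ : 0 < ρ)
    (hρK : ρ ^ 4 ≤ 1 / (6 * K ^ 40)) :
    0 < K ^ 10 * ρ ^ 2 ∧ (K ^ 10 * ρ ^ 2) ^ 2 ≤ 1 / (6 * K ^ 20) := by
  have hK0 : (0 : ℝ) < K := by linarith
  have hK20 : (0 : ℝ) < K ^ 20 := by positivity
  refine ⟨by positivity, ?_⟩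
  have e : (K ^ 10 * ρ ^ 2) ^ 2 = K ^ 20 * ρ ^ 4 := by ring
  rw [e]
  calc K ^ 20 * ρ ^ 4 ≤ K ^ 20 * (1 / (6 * K ^ 40)) := mul_le_mul_of_nonneg_left hρK hK20.le
    _ = 1 / (6 * K ^ 20) := by field_simp

/-! ## §316 The clean dud horizon of the headline member, hypothesis-minimal -/

/-- §316 **THE CLEAN DUD HORIZON OF THE HEADLINE MEMBER** (hypothesis-minimal form of part 118
§314). Let `K ≥ 16`, `0 < ρ`, `ρ⁴ ≤ 1/(6K⁴⁰)`, and let `X` solve (5.5) for the headline member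
`rotorCircuit K K¹⁰ (K¹⁰ρ²) ρ` from `delayInit` (5.6). Then the clean dud horizon (part 118 §313:
the length of the longest pulse-separated run of clean normal-form ignitions `b = θε`,
`5/4 ≤ θ ≤ Θ`, `c = ρ²/K⁹`, `d² + ã² ≤ 1/50`) satisfies
`0.065K⁹ ≤ cleanHorizon K (K¹⁰ρ²) ρ X (29/20)` and
`cleanHorizon K (K¹⁰ρ²) ρ X Θ ≤ ΘK⁹/(7·1.83) + 1` for every `5/4 ≤ Θ ≤ 3/2`.
Part 118 §314 with the trigger primitive supplied by part 14 `exists_catalyst_primitive` and the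
lattice conditions by §315. HONEST FRAMING: low prior, high value-of-information experiment on
Tao's machine paradigm; NOT a claim that NS blows up.
[derived: part 118 §314, part 14 `exists_catalyst_primitive`, this file §315] -/
theorem knob_clean_horizon_headline (hK : 16 ≤ K) (hρ : 0 < ρ)
    (hρK : ρ ^ 4 ≤ 1 / (6 * K ^ 40))
    (hX : ∀ t, HasDerivAt X (RotorKnob.rotorCircuit K (K ^ 10) (K ^ 10 * ρ ^ 2) ρ (X t)) t)
    (h0 : X 0 = delayInit) :
    65 / 1000 * K ^ 9 ≤ (cleanHorizon K (K ^ 10 * ρ ^ 2) ρ X (29 / 20) : ℝ) ∧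
      ∀ Θ : ℝ, 5 / 4 ≤ Θ → Θ ≤ 3 / 2 →
        (cleanHorizon K (K ^ 10 * ρ ^ 2) ρ X Θ : ℝ) ≤ Θ * K ^ 9 / (7 * (183 / 100)) + 1 := by
  obtain ⟨C, hC⟩ := exists_catalyst_primitive hX
  obtain ⟨hε, hεK⟩ := headline_lattice_numerics hK hρ hρK
  exact knob_clean_horizon_two_sided hX h0 hC hK hε hεK hρ rfl

/-- §316 **THE CLEAN DUD HORIZON IS OF EXACT ORDER `K⁹`** (the headline at the ladder's own clock
ceiling `Θ = 29/20`, both edges as decimals): under §316's hypotheses,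
`0.065K⁹ ≤ cleanHorizon K (K¹⁰ρ²) ρ X (29/20) ≤ 0.1132K⁹ + 1` (`(29/20)/(7·1.83) = 0.11319…`).
The two constants are a factor `1.74` apart (part 118's honest limit (iv), inherited).
[derived: this file `knob_clean_horizon_headline`] -/
theorem knob_clean_horizon_order (hK : 16 ≤ K) (hρ : 0 < ρ)
    (hρK : ρ ^ 4 ≤ 1 / (6 * K ^ 40))
    (hX : ∀ t, HasDerivAt X (RotorKnob.rotorCircuit K (K ^ 10) (K ^ 10 * ρ ^ 2) ρ (X t)) t)
    (h0 : X 0 = delayInit) :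
    65 / 1000 * K ^ 9 ≤ (cleanHorizon K (K ^ 10 * ρ ^ 2) ρ X (29 / 20) : ℝ) ∧
      (cleanHorizon K (K ^ 10 * ρ ^ 2) ρ X (29 / 20) : ℝ) ≤ 1132 / 10000 * K ^ 9 + 1 := by
  obtain ⟨hlo, hhi⟩ := knob_clean_horizon_headline hK hρ hρK hX h0
  have hK9 : (0 : ℝ) ≤ K ^ 9 := by positivity
  refine ⟨hlo, (hhi (29 / 20) (by norm_num) (by norm_num)).trans ?_⟩
  have e : (29 / 20 : ℝ) * K ^ 9 / (7 * (183 / 100)) = 2900 / 25620 * K ^ 9 := by ring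
  rw [e]
  nlinarith only [hK9]

end Summit.NavierStokesRegularity.FluidComputer.GateBudget

end
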